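import Literature.AnabelianGeometry.AbsoluteAnabelian.MonoidKummerMapsLiftOfUnitsTransport
import Literature.AnabelianGeometry.AbsoluteAnabelian.AbsAnabUnitsTransportHolds
import Literature.AnabelianGeometry.AbsoluteAnabelian.MonoidKummerMapsTLGLiftCompactProofs
import HarnessLib

/-!
# [IUTchII] Rmk 1.11.1 (i)(a)(b) / [AbsTopIII] Prop 3.2 (iv) mono-analytic surjectivity — HOLD
# (FACT-LIST F-0410 `GaloisIsoLiftsToTMPairIsoOfMonoAnalytic`, F-0411 `TCGPairIsoLiftsOfMonoAnalytic` DISCHARGED)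

S. Mochizuki, *Topics in absolute anabelian geometry III*, Prop. 3.2 (iv) p. 72 (kurims `paper:url-5493eb38cbb7`);
*Inter-universal Teichmüller theory II*, Rmk 1.11.1 (i) p. 50 (kurims `paper:url-5036b4059555`).  The two named facts
of abc-iut-L4-t2's `MonoidKummerMaps.lean` that the Cor 3.12 cone consumes at good places ([IUTchII] Prop 4.2 (i)(ii):
abc-iut-L6-t5 `GoodPrimeKummerBridge.prop42i_of_monoAnalyticLifts` / `prop42iiUnit_of_tcgLifts`) are PROVED, by
composing abc-iut-L4-d3's `Prop121vii.unitsTransport_holds` ([AbsAnab] Prop 1.2.1 row L02: the `α`-equivariant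
`ψ̄ : K̄₁^× ⥲ K̄₂^×` from local class field theory + Verlagerung) with the bridge
`galoisIsoLiftsToTMPairIsoOfMonoAnalytic_of_unitsTransport` / `tcgPairIsoLiftsOfMonoAnalytic_of_unitsTransport`
(abc-iut-L6-t13) over abc-iut-L6-d1's reduction chain `MonoidKummerMapsTLGLift{Reduction,Transport}` and
abc-iut-L6-t21's `tmPairIso_lifts_of_tlgLifting_monoAnalytic`; and, for hypothesis predicates `H` under which `Π` is
COMPACT (profinite étale `π₁`), the `H`-schema forms F-0409 `GaloisIsoLiftsToTMPairIso H` / F-0413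
`UnitPairIsoFibresOfType H` via abc-iut-L6-t13 (gen 3)'s `MonoidKummerMapsTLGLiftCompactProofs` (continuity of the
covered Galois isomorphism for open augmentations).  Closing types fully qualified.
HONEST FRAMING: OUR kernel proof of a statement of a refereed paper ([AbsTopIII] 2015) from classical LCFT; nothing
here bears on [IUTchIII] Cor. 3.12 and nothing asserts that abc is proved or refuted.
-/

namespace Literature.AnabelianGeometry.AbsoluteAnabelian

/-- **F-0410 HOLDS**: [IUTchII] Rmk 1.11.1 (i)(a) / [AbsTopIII] Prop 3.2 (iv) — every isomorphism of topological
groups between MLF-Galois `TM`-pairs of mono-analytic type lifts to an isomorphism of pairs.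
[cite: Mochizuki2012, II Rmk 1.11.1 (i) p.50] [cite: MochizukiAbsTopIII2015, Proposition 3.2 (iv) p.72] -/
theorem galoisIsoLiftsToTMPairIsoOfMonoAnalytic_holds :
    Literature.AnabelianGeometry.AbsoluteAnabelian.GaloisIsoLiftsToTMPairIsoOfMonoAnalytic :=
  galoisIsoLiftsToTMPairIsoOfMonoAnalytic_of_unitsTransport Prop121vii.unitsTransport_holds

/-- **F-0411 HOLDS**: [IUTchII] Rmk 1.11.1 (i)(b) — every pair `(f, u)` of an isomorphism of topological groups and
an isomorphism of cyclotomes between MLF-Galois `TCG`-pairs of mono-analytic type is realised by an isomorphism of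
pairs. [cite: Mochizuki2012, II Rmk 1.11.1 (i) p.50] [cite: MochizukiAbsTopIII2015, Proposition 3.2 (iv) p.72] -/
theorem tcgPairIsoLiftsOfMonoAnalytic_holds :
    Literature.AnabelianGeometry.AbsoluteAnabelian.TCGPairIsoLiftsOfMonoAnalytic :=
  tcgPairIsoLiftsOfMonoAnalytic_of_unitsTransport Prop121vii.unitsTransport_holds

/-- The underlying mono-analytic `TLG` lifting ([AbsTopIII] Prop 3.3 (ii) surjectivity for pairs of mono-analytic
type), unconditionally. [cite: MochizukiAbsTopIII2015, Proposition 3.3 (ii) p.74] -/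
theorem tlgLifting_monoAnalytic_holds (P Q : GaloisMonoidPair.{0}) (hP : IsMLFGaloisMonoidPair .TLG P)
    (hQ : IsMLFGaloisMonoidPair .TLG Q) (hPm : IsOfMonoAnalyticTypeMonoid .TLG P)
    (hQm : IsOfMonoAnalyticTypeMonoid .TLG Q) (f : P.Pi ≃ₜ* Q.Pi) :
    ∃ e : GaloisMonoidPair.Iso P Q, e.isoPi = f :=
  tlgLifting_monoAnalytic_of_unitsTransport Prop121vii.unitsTransport_holds P Q hP hQ hPm hQm f

/-- The bi-anabelian statement (BA) of abc-iut-L6-d1's reduction chain, unconditionally, for arbitrary MLF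
closure data. [cite: MochizukiAbsTopIII2015, Proposition 3.2 (iv) p.72] -/
theorem biAnabelianUnits_holds (C₁ C₂ : MLFClosure.{0}) (α : (C₁.K ≃ₐ[C₁.k] C₁.K) ≃ₜ* (C₂.K ≃ₐ[C₂.k] C₂.K)) :
    ∃ β : ↥(nonZeroDivisors C₁.K) ≃* ↥(nonZeroDivisors C₂.K),
      ∀ (σ : C₁.K ≃ₐ[C₁.k] C₁.K) (x y : ↥(nonZeroDivisors C₁.K)), (y : C₁.K) = σ x →
        ((β y : ↥(nonZeroDivisors C₂.K)) : C₂.K) = α σ ((β x : ↥(nonZeroDivisors C₂.K)) : C₂.K) :=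
  biAnabelianUnits_of_unitsTransport Prop121vii.unitsTransport_holds C₁ C₂ α

/-! ### The `H`-schema forms for COMPACT `Π` (F-0409 / F-0413 at every compact-`Π` hypothesis predicate) -/

/-- **F-0409 for compact `Π`**: abc-iut-L4-t2's schema `GaloisIsoLiftsToTMPairIso H` ([AbsTopIII] Prop 3.2 (iv) in the
author's corrected form, «of hyperbolic orbicurve type») HOLDS for every hypothesis predicate `H` under which `Π` is
compact — unconditionally (BA proved; abc-iut-L6-t13 gen 3's compact reduction).
[cite: MochizukiAbsTopIII2015, Proposition 3.2 (iv) p.72] [cite: MochizukiAbsTopIIIComments2019, item (5)] -/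
theorem galoisIsoLiftsToTMPairIso_of_compact_holds (H : GaloisMonoidPair.{0} → Prop)
    (hH : ∀ P, H P → CompactSpace P.Pi) :
    Literature.AnabelianGeometry.AbsoluteAnabelian.GaloisIsoLiftsToTMPairIso H :=
  galoisIsoLiftsToTMPairIso_of_biAnabelianUnits_of_compact biAnabelianUnits_holds H hH

/-- **F-0413 for compact `Π`**: abc-iut-L4-t2's corrected [AbsTopIII] Prop 3.3 (ii) schema `UnitPairIsoFibresOfType H`
HOLDS for every hypothesis predicate `H` under which `Π` is compact — unconditionally.
[cite: MochizukiAbsTopIII2015, Proposition 3.3 (ii) p.74] -/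
theorem unitPairIsoFibresOfType_of_compact_holds (H : GaloisMonoidPair.{0} → Prop)
    (hH : ∀ P, H P → CompactSpace P.Pi) :
    Literature.AnabelianGeometry.AbsoluteAnabelian.UnitPairIsoFibresOfType H :=
  unitPairIsoFibresOfType_of_biAnabelianUnits_of_compact biAnabelianUnits_holds H hH

/-- The `TLG` lifting for COMPACT `Π`, unconditionally: every isomorphism of topological groups between MLF-Galois
`TLG`-pairs with compact `Π` that respects the arithmetic quotients lifts to an isomorphism of pairs.
[cite: MochizukiAbsTopIII2015, Proposition 3.3 (ii) p.74] -/
theorem tlgLifting_compact_holds (P Q : GaloisMonoidPair.{0}) (hP : IsMLFGaloisMonoidPair .TLG P)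
    (hQ : IsMLFGaloisMonoidPair .TLG Q) (hPc : CompactSpace P.Pi) (hQc : CompactSpace Q.Pi) (f : P.Pi ≃ₜ* Q.Pi)
    (hf : P.actionKer.map f.toMulEquiv.toMonoidHom = Q.actionKer) :
    ∃ e : GaloisMonoidPair.Iso P Q, e.isoPi = f :=
  tlgLifting_compact_of_biAnabelianUnits biAnabelianUnits_holds P Q hP hQ hPc hQc f hf

/-- The `TCG` lifting for compact-`Π` hypothesis predicates, unconditionally.
[cite: MochizukiAbsTopIII2015, Proposition 3.3 (ii) p.74] -/
theorem tcgLifting_compact_holds (H : GaloisMonoidPair.{0} → Prop) (hH : ∀ P, H P → CompactSpace P.Pi)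
    (P Q : GaloisMonoidPair.{0}) (hP : IsMLFGaloisMonoidPair .TCG P) (hQ : IsMLFGaloisMonoidPair .TCG Q)
    (hHP : H P) (hHQ : H Q) (f : P.Pi ≃ₜ* Q.Pi) (hf : P.actionKer.map f.toMulEquiv.toMonoidHom = Q.actionKer) :
    ∃ e : GaloisMonoidPair.Iso P Q, e.isoPi = f :=
  tcgLifting_compact_of_biAnabelianUnits biAnabelianUnits_holds H hH P Q hP hQ hHP hHQ f hf

end Literature.AnabelianGeometry.AbsoluteAnabelian
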